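import Literature.NumberTheory.LFunctions.WeilCombNodeWeightsCount
import HarnessLib

/-!
# Node weights of `ζ`-mollified combs, VI: the node weight of one pair `(ℓ, ℓ')`

Topic `Literature/NumberTheory/LFunctions`.  Summing the four ranges of
`Literature/NumberTheory/LFunctions/WeilCombNodeWeightsTerms.lean` over `k' ≤ M` gives the
evaluation of the node weight of one pair of resonator indices at the node `log n`
(`0 < h ≤ 1/(32L)`, `hM ≥ 1`, `h²M ≤ 1`, `1 ≤ ℓ, ℓ' ≤ L`, `B ≥ 0` a `C²` bump autocorrelation
supported in `[-2,2]`):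

* `node_weight_pair` —
  `|n^{-1/2} ∑_{k' ≤ M} k'^{-1/2} S(log(nℓ'k'/ℓ)) - B(0)(√ℓ/√ℓ') D(n)/n - h β_h (√ℓ'/√ℓ) N(n)|`
  `≤ (8 C₂ L + 64 N₀ L²)/n + 8 N₀ L h`,
  with the DIAGONAL count `D(n) = ∑_{k' ≤ K₀(n)} 𝟙[ℓ ∣ nℓ'k']/k'`, `K₀(n) = ⌊1/(4h n ℓ')⌋`,
  the SMOOTH count `N(n) = min(M, ⌊ℓ M e^{-2h}/(ℓ' n)⌋) - K₀(n)`, `β_h = ∫ B(v)e^{-hv/2} dv` and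
  `C₂ = (N₀+2N₁+N₂)(96+192L)L²`;
* the three blocks `node_block_sparse`, `node_block_dense`, `node_block_edge` of the `k'`-sum.

The error `O(1/n + h)` summed against any `f ≥ 0` with `∑_{n ≤ x} f(n) ≤ Ax` is `O(A log M)`,
one logarithm below the diagonal main term.  Everything is proved; no named facts.
-/

noncomputable section

open MeasureTheory Set

namespace Literature.NumberTheory.LFunctions

/-! ## The three blocks of the `k'`-sum -/

section Blocks

variable {B B' B'' : ℝ → ℝ} {N₀ N₁ N₂ h : ℝ} {L n ℓ ℓ' M : ℕ}

/-- **Sparse block**: for `k' ≤ K₀` every term is diagonal,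
`∑_{k' ≤ K₀} T(k') = B(0)(√ℓ/√ℓ') (∑_{k' ≤ K₀} 𝟙[ℓ ∣ nℓ'k']/k')/n`. [folklore] -/
theorem node_block_sparse (hBs : ∀ x, 2 < |x| → B x = 0) (hℓ : 1 ≤ ℓ) (hℓ' : 1 ≤ ℓ') (hn : 1 ≤ n)
    (hh : 0 < h) (hh4 : h < 1 / 4) (hhM : 1 ≤ h * M) :
    ∑ k' ∈ Finset.Icc 1 ⌊1 / (4 * h) / ((n : ℝ) * ℓ')⌋₊,
        (∑ k ∈ Finset.Icc 1 M, B ((Real.log ((n : ℝ) * ℓ' * k' / ℓ) - Real.log k) / h) / Real.sqrt k)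
          / Real.sqrt k' / Real.sqrt n
      = B 0 * (Real.sqrt ℓ / Real.sqrt ℓ') *
          (∑ k' ∈ Finset.Icc 1 ⌊1 / (4 * h) / ((n : ℝ) * ℓ')⌋₊,
            (if ℓ ∣ n * ℓ' * k' then 1 / (k' : ℝ) else 0)) / n := by
  obtain ⟨-, -, hK₀, hYM⟩ := node_ranges hℓ hℓ' hn hh hh4.le hhM
  rw [Finset.mul_sum, Finset.sum_div]
  refine Finset.sum_congr rfl fun k' hk' ↦ ?_
  obtain ⟨hk'1, hk'K₀⟩ := Finset.mem_Icc.1 hk'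
  have hlow : (n : ℝ) * ℓ' * k' ≤ 1 / (4 * h) := by
    have : (n : ℝ) * ℓ' * k' ≤ (n : ℝ) * ℓ' * ⌊1 / (4 * h) / ((n : ℝ) * ℓ')⌋₊ :=
      mul_le_mul_of_nonneg_left (by exact_mod_cast hk'K₀) (by positivity)
    exact this.trans hK₀
  have hM' : n * ℓ' * k' ≤ M := by
    have : (n : ℝ) * ℓ' * k' ≤ M := hlow.trans hYM
    exact_mod_cast this
  rw [node_term_sparse hBs hh hh4 hℓ hℓ' hn hk'1 hlow hM']

/-- **Dense interior block**: for `K₀ < k' ≤ K₁` each term is `hβ_h√ℓ'/√ℓ + O(C₂/(h(nk')²))`.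
[folklore] -/
theorem node_block_dense
    (hB : ∀ x, HasDerivAt B (B' x) x) (hB' : ∀ x, HasDerivAt B' (B'' x) x)
    (h0 : ∀ x, |B x| ≤ N₀) (h1 : ∀ x, |B' x| ≤ N₁) (h2 : ∀ x, |B'' x| ≤ N₂)
    (hBs : ∀ x, 2 < |x| → B x = 0)
    (hL : 1 ≤ L) (hℓ : 1 ≤ ℓ) (hℓL : ℓ ≤ L) (hℓ' : 1 ≤ ℓ') (hn : 1 ≤ n)
    (hh : 0 < h) (hhL : h ≤ 1 / (32 * L)) :
    |∑ k' ∈ Finset.Ioc ⌊1 / (4 * h) / ((n : ℝ) * ℓ')⌋₊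
          (min M ⌊(ℓ : ℝ) * M * Real.exp (-(2 * h)) / (ℓ' * n)⌋₊),
        ((∑ k ∈ Finset.Icc 1 M, B ((Real.log ((n : ℝ) * ℓ' * k' / ℓ) - Real.log k) / h) / Real.sqrt k)
            / Real.sqrt k' / Real.sqrt n
          - h * (∫ v, B v * Real.exp (-(h * v) / 2)) * (Real.sqrt ℓ' / Real.sqrt ℓ))|
      ≤ ∑ k' ∈ Finset.Ioc ⌊1 / (4 * h) / ((n : ℝ) * ℓ')⌋₊
          (min M ⌊(ℓ : ℝ) * M * Real.exp (-(2 * h)) / (ℓ' * n)⌋₊),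
        (N₀ + 2 * N₁ + N₂) * (96 + 192 * L) * L ^ 2 / (h * ((n : ℝ) * k') ^ 2) := by
  refine (Finset.abs_sum_le_sum_abs _ _).trans (Finset.sum_le_sum fun k' hk' ↦ ?_)
  obtain ⟨hk'K₀, hk'K₁⟩ := Finset.mem_Ioc.1 hk'
  have hk'1 : 1 ≤ k' := by omega
  have hlow := node_low_of_lt hℓ' hn hk'K₀
  have hup : (n : ℝ) * ℓ' * k' * Real.exp (2 * h) ≤ ℓ * M := by
    have hk1 : k' ≤ ⌊(ℓ : ℝ) * M * Real.exp (-(2 * h)) / (ℓ' * n)⌋₊ := hk'K₁.trans (min_le_right _ _)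
    have hℓ'R : (1 : ℝ) ≤ ℓ' := by exact_mod_cast hℓ'
    have hnR : (1 : ℝ) ≤ n := by exact_mod_cast hn
    have hk2 : (k' : ℝ) ≤ (ℓ : ℝ) * M * Real.exp (-(2 * h)) / (ℓ' * n) :=
      le_trans (by exact_mod_cast hk1) (Nat.floor_le (by positivity))
    rw [le_div_iff₀ (by positivity)] at hk2
    have he : Real.exp (-(2 * h)) * Real.exp (2 * h) = 1 := by
      rw [← Real.exp_add, neg_add_cancel, Real.exp_zero]
    calc (n : ℝ) * ℓ' * k' * Real.exp (2 * h) = k' * (ℓ' * n) * Real.exp (2 * h) := by ring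
      _ ≤ (ℓ : ℝ) * M * Real.exp (-(2 * h)) * Real.exp (2 * h) :=
          mul_le_mul_of_nonneg_right hk2 (Real.exp_pos _).le
      _ = ℓ * M := by rw [mul_assoc, he, mul_one]
  exact node_term_dense hB hB' h0 h1 h2 hBs hL hℓ hℓL hℓ' hn hk'1 hh hhL hlow hup

/-- **Edge block**: for `K₁ < k' ≤ M` the terms are nonnegative, at most `8hLM/n + 1` of them are
nonzero, each at most `hβ_h L + O(C₂/(h(nk')²))`. [folklore] -/
theorem node_block_edge
    (hB : ∀ x, HasDerivAt B (B' x) x) (hB' : ∀ x, HasDerivAt B' (B'' x) x)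
    (h0 : ∀ x, |B x| ≤ N₀) (h1 : ∀ x, |B' x| ≤ N₁) (h2 : ∀ x, |B'' x| ≤ N₂)
    (hBs : ∀ x, 2 < |x| → B x = 0) (hB0 : ∀ x, 0 ≤ B x)
    (hL : 1 ≤ L) (hℓ : 1 ≤ ℓ) (hℓL : ℓ ≤ L) (hℓ' : 1 ≤ ℓ') (hℓ'L : ℓ' ≤ L) (hn : 1 ≤ n)
    (hh : 0 < h) (hhL : h ≤ 1 / (32 * L)) (hhM : 1 ≤ h * M) :
    0 ≤ ∑ k' ∈ Finset.Ioc (min M ⌊(ℓ : ℝ) * M * Real.exp (-(2 * h)) / (ℓ' * n)⌋₊) M,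
        (∑ k ∈ Finset.Icc 1 M, B ((Real.log ((n : ℝ) * ℓ' * k' / ℓ) - Real.log k) / h) / Real.sqrt k)
          / Real.sqrt k' / Real.sqrt n ∧
    ∑ k' ∈ Finset.Ioc (min M ⌊(ℓ : ℝ) * M * Real.exp (-(2 * h)) / (ℓ' * n)⌋₊) M,
        (∑ k ∈ Finset.Icc 1 M, B ((Real.log ((n : ℝ) * ℓ' * k' / ℓ) - Real.log k) / h) / Real.sqrt k)
          / Real.sqrt k' / Real.sqrt n
      ≤ h * (∫ v, B v * Real.exp (-(h * v) / 2)) * L * (8 * h * L * M / n + 1)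
        + ∑ k' ∈ Finset.Ioc (min M ⌊(ℓ : ℝ) * M * Real.exp (-(2 * h)) / (ℓ' * n)⌋₊) M,
            (N₀ + 2 * N₁ + N₂) * (96 + 192 * L) * L ^ 2 / (h * ((n : ℝ) * k') ^ 2) := by
  have hN₀ : 0 ≤ N₀ := (abs_nonneg _).trans (h0 0)
  have hN₁ : 0 ≤ N₁ := (abs_nonneg _).trans (h1 0)
  have hN₂ : 0 ≤ N₂ := (abs_nonneg _).trans (h2 0)
  have hLR : (1 : ℝ) ≤ L := by exact_mod_cast hL
  have hℓR : (1 : ℝ) ≤ ℓ := by exact_mod_cast hℓ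
  have hℓ'LR : (ℓ' : ℝ) ≤ L := by exact_mod_cast hℓ'L
  have hnR : (1 : ℝ) ≤ n := by exact_mod_cast hn
  have h32 : 1 / (32 * (L : ℝ)) ≤ 1 / 32 := one_div_le_one_div_of_le (by norm_num) (by linarith)
  have hh4 : h ≤ 1 / 4 := by linarith
  obtain ⟨hK₀K₁, -, -, -⟩ := node_ranges hℓ hℓ' hn hh hh4 hhM
  set β : ℝ := ∫ v, B v * Real.exp (-(h * v) / 2) with hβ
  have hβ0 : 0 ≤ β := toothBeta_nonneg hB0 h
  have hratio : Real.sqrt ℓ' / Real.sqrt ℓ ≤ L := by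
    have h1' : Real.sqrt (ℓ' : ℝ) ≤ L := by
      rw [Real.sqrt_le_left (by linarith)]; nlinarith
    have h2' : 1 ≤ Real.sqrt (ℓ : ℝ) := by rw [Real.le_sqrt' one_pos]; simpa using hℓR
    calc Real.sqrt ℓ' / Real.sqrt ℓ ≤ Real.sqrt ℓ' / 1 :=
          div_le_div_of_nonneg_left (Real.sqrt_nonneg _) one_pos h2'
      _ ≤ L := by rw [div_one]; exact h1'
  -- pointwise
  have hpt : ∀ k' ∈ Finset.Ioc (min M ⌊(ℓ : ℝ) * M * Real.exp (-(2 * h)) / (ℓ' * n)⌋₊) M,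
      0 ≤ (∑ k ∈ Finset.Icc 1 M, B ((Real.log ((n : ℝ) * ℓ' * k' / ℓ) - Real.log k) / h) / Real.sqrt k)
          / Real.sqrt k' / Real.sqrt n ∧
      (∑ k ∈ Finset.Icc 1 M, B ((Real.log ((n : ℝ) * ℓ' * k' / ℓ) - Real.log k) / h) / Real.sqrt k)
          / Real.sqrt k' / Real.sqrt n
        ≤ (if (n : ℝ) * ℓ' * k' ≤ ℓ * M * Real.exp (2 * h) then h * β * L else 0)
          + (N₀ + 2 * N₁ + N₂) * (96 + 192 * L) * L ^ 2 / (h * ((n : ℝ) * k') ^ 2) := by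
    intro k' hk'
    obtain ⟨hk'K₁, hk'M⟩ := Finset.mem_Ioc.1 hk'
    have hk'K₀ : ⌊1 / (4 * h) / ((n : ℝ) * ℓ')⌋₊ < k' := lt_of_le_of_lt hK₀K₁ hk'K₁
    have hk'1 : 1 ≤ k' := by omega
    have hlow := node_low_of_lt hℓ' hn hk'K₀
    obtain ⟨hT0, hTle⟩ := node_term_edge (M := M) hB hB' h0 h1 h2 hBs hB0 hL hℓ hℓL hℓ' hn hk'1 hh
      hhL hlow
    refine ⟨hT0, ?_⟩
    split_ifs with hcond
    · have : h * β * (Real.sqrt ℓ' / Real.sqrt ℓ) ≤ h * β * L :=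
        mul_le_mul_of_nonneg_left hratio (by positivity)
      linarith
    · rw [node_term_beyond hBs hh hℓ (not_le.1 hcond), zero_add]
      positivity
  refine ⟨Finset.sum_nonneg fun k' hk' ↦ (hpt k' hk').1, ?_⟩
  have hcard := card_edge_le (M := M) hh hh4 hn hℓ hℓL hℓ'
  calc ∑ k' ∈ Finset.Ioc (min M ⌊(ℓ : ℝ) * M * Real.exp (-(2 * h)) / (ℓ' * n)⌋₊) M,
        (∑ k ∈ Finset.Icc 1 M, B ((Real.log ((n : ℝ) * ℓ' * k' / ℓ) - Real.log k) / h) / Real.sqrt k)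
          / Real.sqrt k' / Real.sqrt n
      ≤ ∑ k' ∈ Finset.Ioc (min M ⌊(ℓ : ℝ) * M * Real.exp (-(2 * h)) / (ℓ' * n)⌋₊) M,
          ((if (n : ℝ) * ℓ' * k' ≤ ℓ * M * Real.exp (2 * h) then h * β * L else 0)
            + (N₀ + 2 * N₁ + N₂) * (96 + 192 * L) * L ^ 2 / (h * ((n : ℝ) * k') ^ 2)) :=
        Finset.sum_le_sum fun k' hk' ↦ (hpt k' hk').2
    _ = (((Finset.Ioc (min M ⌊(ℓ : ℝ) * M * Real.exp (-(2 * h)) / (ℓ' * n)⌋₊) M).filter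
            (fun k' : ℕ ↦ (n : ℝ) * ℓ' * k' ≤ ℓ * M * Real.exp (2 * h))).card : ℝ) * (h * β * L)
          + ∑ k' ∈ Finset.Ioc (min M ⌊(ℓ : ℝ) * M * Real.exp (-(2 * h)) / (ℓ' * n)⌋₊) M,
            (N₀ + 2 * N₁ + N₂) * (96 + 192 * L) * L ^ 2 / (h * ((n : ℝ) * k') ^ 2) := by
        rw [Finset.sum_add_distrib, Finset.sum_ite, Finset.sum_const_zero, add_zero, Finset.sum_const,
          nsmul_eq_mul]
    _ ≤ _ := by
        have := mul_le_mul_of_nonneg_right hcard (by positivity : 0 ≤ h * β * L)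
        linarith

end Blocks

/-! ## The node weight of one pair -/

/-- **Node weight of one pair `(ℓ, ℓ')` at the node `log n`.**  For `0 < h ≤ 1/(32L)`, `hM ≥ 1`,
`h²M ≤ 1`, `1 ≤ ℓ, ℓ' ≤ L`, `n ≥ 1` and a `C²` bump autocorrelation `B ≥ 0` supported in `[-2,2]`
(`|B| ≤ N₀`, `|B'| ≤ N₁`, `|B''| ≤ N₂`):
`|n^{-1/2} ∑_{k' ≤ M} k'^{-1/2} S(log(nℓ'k'/ℓ)) - B(0)(√ℓ/√ℓ') D(n)/n - h β_h (√ℓ'/√ℓ) N(n)|`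
`≤ (8 C₂ L + 64 N₀ L²)/n + 8 N₀ L h`, `D(n) = ∑_{k' ≤ ⌊1/(4hnℓ')⌋} 𝟙[ℓ ∣ nℓ'k']/k'`,
`N(n) = min(M, ⌊ℓMe^{-2h}/(ℓ'n)⌋) - ⌊1/(4hnℓ')⌋`, `C₂ = (N₀+2N₁+N₂)(96+192L)L²`. [folklore] -/
theorem node_weight_pair {B B' B'' : ℝ → ℝ} {N₀ N₁ N₂ h : ℝ} {L n ℓ ℓ' M : ℕ}
    (hB : ∀ x, HasDerivAt B (B' x) x) (hB' : ∀ x, HasDerivAt B' (B'' x) x)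
    (h0 : ∀ x, |B x| ≤ N₀) (h1 : ∀ x, |B' x| ≤ N₁) (h2 : ∀ x, |B'' x| ≤ N₂)
    (hBs : ∀ x, 2 < |x| → B x = 0) (hB0 : ∀ x, 0 ≤ B x)
    (hL : 1 ≤ L) (hℓ : 1 ≤ ℓ) (hℓL : ℓ ≤ L) (hℓ' : 1 ≤ ℓ') (hℓ'L : ℓ' ≤ L) (hn : 1 ≤ n)
    (hh : 0 < h) (hhL : h ≤ 1 / (32 * L)) (hhM : 1 ≤ h * M) (hhM2 : h ^ 2 * M ≤ 1) :
    |(∑ k' ∈ Finset.Icc 1 M,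
        (∑ k ∈ Finset.Icc 1 M, B ((Real.log ((n : ℝ) * ℓ' * k' / ℓ) - Real.log k) / h) / Real.sqrt k)
          / Real.sqrt k' / Real.sqrt n)
      - B 0 * (Real.sqrt ℓ / Real.sqrt ℓ') *
          (∑ k' ∈ Finset.Icc 1 ⌊1 / (4 * h) / ((n : ℝ) * ℓ')⌋₊,
            (if ℓ ∣ n * ℓ' * k' then 1 / (k' : ℝ) else 0)) / n
      - h * (∫ v, B v * Real.exp (-(h * v) / 2)) * (Real.sqrt ℓ' / Real.sqrt ℓ) *
          ((min M ⌊(ℓ : ℝ) * M * Real.exp (-(2 * h)) / (ℓ' * n)⌋₊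
              - ⌊1 / (4 * h) / ((n : ℝ) * ℓ')⌋₊ : ℕ) : ℝ)|
      ≤ (8 * ((N₀ + 2 * N₁ + N₂) * (96 + 192 * L) * L ^ 2) * L + 64 * N₀ * L ^ 2) / n
        + 8 * N₀ * L * h := by
  have hN₀ : 0 ≤ N₀ := (abs_nonneg _).trans (h0 0)
  have hN₁ : 0 ≤ N₁ := (abs_nonneg _).trans (h1 0)
  have hN₂ : 0 ≤ N₂ := (abs_nonneg _).trans (h2 0)
  have hLR : (1 : ℝ) ≤ L := by exact_mod_cast hL
  have hnR : (1 : ℝ) ≤ n := by exact_mod_cast hn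
  have hn0 : (0 : ℝ) < n := by linarith
  have h32 : 1 / (32 * (L : ℝ)) ≤ 1 / 32 := one_div_le_one_div_of_le (by norm_num) (by linarith)
  have hh4 : h < 1 / 4 := by linarith
  obtain ⟨hK₀K₁, hK₁M, -, -⟩ := node_ranges hℓ hℓ' hn hh hh4.le hhM
  -- names
  set T : ℕ → ℝ := fun k' ↦
    (∑ k ∈ Finset.Icc 1 M, B ((Real.log ((n : ℝ) * ℓ' * k' / ℓ) - Real.log k) / h) / Real.sqrt k)
      / Real.sqrt k' / Real.sqrt n with hT
  set K₀ : ℕ := ⌊1 / (4 * h) / ((n : ℝ) * ℓ')⌋₊ with hK₀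
  set K₁ : ℕ := min M ⌊(ℓ : ℝ) * M * Real.exp (-(2 * h)) / (ℓ' * n)⌋₊ with hK₁
  set β : ℝ := ∫ v, B v * Real.exp (-(h * v) / 2) with hβ
  set C₂ : ℝ := (N₀ + 2 * N₁ + N₂) * (96 + 192 * L) * L ^ 2 with hC₂
  set err : ℕ → ℝ := fun k' ↦ C₂ / (h * ((n : ℝ) * k') ^ 2) with herr
  set mainD : ℝ := h * β * (Real.sqrt ℓ' / Real.sqrt ℓ) with hmainD
  have hβ0 : 0 ≤ β := toothBeta_nonneg hB0 h
  have hβ8 : β ≤ 8 * N₀ := toothBeta_le hB0 h0 hBs hh.le hh4.le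
  have hC₂0 : 0 ≤ C₂ := by positivity
  -- the three blocks
  have hIcc : Finset.Icc 1 M = Finset.Ioc 0 M := by
    ext k; simp only [Finset.mem_Icc, Finset.mem_Ioc]; omega
  have hIcc0 : Finset.Icc 1 K₀ = Finset.Ioc 0 K₀ := by
    ext k; simp only [Finset.mem_Icc, Finset.mem_Ioc]; omega
  have hsplit : ∑ k' ∈ Finset.Icc 1 M, T k'
      = ∑ k' ∈ Finset.Icc 1 K₀, T k' + ∑ k' ∈ Finset.Ioc K₀ K₁, T k' + ∑ k' ∈ Finset.Ioc K₁ M, T k' := by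
    rw [hIcc, hIcc0, ← Finset.sum_Ioc_consecutive _ (Nat.zero_le K₀) (hK₀K₁.trans hK₁M),
      ← Finset.sum_Ioc_consecutive _ hK₀K₁ hK₁M, add_assoc]
  have hb1 := node_block_sparse (M := M) hBs hℓ hℓ' hn hh hh4 hhM
  have hb2 := node_block_dense (M := M) hB hB' h0 h1 h2 hBs hL hℓ hℓL hℓ' hn hh hhL
  obtain ⟨hb3pos, hb3⟩ := node_block_edge (M := M) hB hB' h0 h1 h2 hBs hB0 hL hℓ hℓL hℓ' hℓ'L hn hh hhL hhM
  -- the dense block as `∑ T - mainD · #`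
  have hcard : ∑ k' ∈ Finset.Ioc K₀ K₁, (T k' - mainD)
      = ∑ k' ∈ Finset.Ioc K₀ K₁, T k' - mainD * ((K₁ - K₀ : ℕ) : ℝ) := by
    rw [Finset.sum_sub_distrib, Finset.sum_const, Nat.card_Ioc, nsmul_eq_mul, mul_comm]
  -- the error sums
  have herrsum : ∑ k' ∈ Finset.Ioc K₀ K₁, err k' + ∑ k' ∈ Finset.Ioc K₁ M, err k' ≤ 8 * C₂ * L / n := by
    rw [Finset.sum_Ioc_consecutive _ hK₀K₁ hK₁M]
    have hs := sum_Ioc_inv_sq_le_of_floor (M := M) hh hn hℓ' hℓ'L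
    have heq : ∑ k' ∈ Finset.Ioc K₀ M, err k' = C₂ / (h * (n : ℝ) ^ 2) *
        ∑ k' ∈ Finset.Ioc K₀ M, ((k' : ℝ) ^ 2)⁻¹ := by
      rw [Finset.mul_sum]
      refine Finset.sum_congr rfl fun k' hk' ↦ ?_
      have hk'0 : (0 : ℝ) < k' := by
        have : 1 ≤ k' := by have := (Finset.mem_Ioc.1 hk').1; omega
        exact_mod_cast this
      simp only [herr]
      field_simp
    rw [heq]
    calc C₂ / (h * (n : ℝ) ^ 2) * ∑ k' ∈ Finset.Ioc K₀ M, ((k' : ℝ) ^ 2)⁻¹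
        ≤ C₂ / (h * (n : ℝ) ^ 2) * (8 * h * n * L) := mul_le_mul_of_nonneg_left hs (by positivity)
      _ = 8 * C₂ * L / n := by field_simp
  -- assemble
  have hkey : ∑ k' ∈ Finset.Icc 1 M, T k'
      - B 0 * (Real.sqrt ℓ / Real.sqrt ℓ') *
          (∑ k' ∈ Finset.Icc 1 K₀, (if ℓ ∣ n * ℓ' * k' then 1 / (k' : ℝ) else 0)) / n
      - mainD * ((K₁ - K₀ : ℕ) : ℝ)
      = ∑ k' ∈ Finset.Ioc K₀ K₁, (T k' - mainD) + ∑ k' ∈ Finset.Ioc K₁ M, T k' := by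
    rw [hsplit, hcard, hb1]; ring
  rw [hkey]
  have hedge : h * β * L * (8 * h * L * M / n + 1) ≤ 64 * N₀ * L ^ 2 / n + 8 * N₀ * L * h := by
    have e1 : h * β * L * (8 * h * L * M / n + 1) = 8 * (h ^ 2 * M) * β * L ^ 2 / n + β * L * h := by
      ring
    rw [e1]
    have t1 : 8 * (h ^ 2 * M) * β * L ^ 2 / n ≤ 64 * N₀ * L ^ 2 / n := by
      apply div_le_div_of_nonneg_right _ hn0.le
      have : (h ^ 2 * M) * β ≤ 1 * (8 * N₀) := mul_le_mul hhM2 hβ8 hβ0 zero_le_one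
      nlinarith [sq_nonneg (L : ℝ)]
    have t2 : β * L * h ≤ 8 * N₀ * L * h := by
      have : β * L ≤ 8 * N₀ * L := mul_le_mul_of_nonneg_right hβ8 (by positivity)
      exact mul_le_mul_of_nonneg_right this hh.le
    linarith
  calc |∑ k' ∈ Finset.Ioc K₀ K₁, (T k' - mainD) + ∑ k' ∈ Finset.Ioc K₁ M, T k'|
      ≤ |∑ k' ∈ Finset.Ioc K₀ K₁, (T k' - mainD)| + |∑ k' ∈ Finset.Ioc K₁ M, T k'| := abs_add_le _ _
    _ ≤ ∑ k' ∈ Finset.Ioc K₀ K₁, err k'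
          + (h * β * L * (8 * h * L * M / n + 1) + ∑ k' ∈ Finset.Ioc K₁ M, err k') := by
        rw [abs_of_nonneg hb3pos]
        exact add_le_add hb2 hb3
    _ = (∑ k' ∈ Finset.Ioc K₀ K₁, err k' + ∑ k' ∈ Finset.Ioc K₁ M, err k')
          + h * β * L * (8 * h * L * M / n + 1) := by ring
    _ ≤ 8 * C₂ * L / n + (64 * N₀ * L ^ 2 / n + 8 * N₀ * L * h) := add_le_add herrsum hedge
    _ = (8 * C₂ * L + 64 * N₀ * L ^ 2) / n + 8 * N₀ * L * h := by
        rw [add_div]; ring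

end Literature.NumberTheory.LFunctions
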